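import Summits.CriticalPhenomena.PercolationContinuityZ3.Theorems.SoloInformedBackboneThreshold
import Summits.CriticalPhenomena.PercolationContinuityZ3.Theorems.SoloInformedBackboneTwoPoint
import Summits.CriticalPhenomena.PercolationContinuityZ3.Theorems.SoloInformedNoCriticalBackbone
import Literature.Probability.Percolation.HalfSpaceBGN
import Literature.Probability.Percolation.DeletionTolerance
import Literature.Probability.Percolation.SharpnessDCTProofs
import Literature.Probability.Percolation.CriticalContinuityProofs
import HarnessLib

/-!
# The backbone density does not jump from the right (portrait item S17′, second half)

Solo seat `solo-CriticalPhenomena-informed`. Let `B(p) = P_p(0 is robust)`, the density of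
vertices whose open cluster is infinite and stays infinite after closing any single edge
(`robust`, `SoloInformedHangingBridges`). `SoloInformedNoCriticalBackbone` proved the jump-world
dichotomy `θ(p_c) > 0 ⇒ χᶠ(p_c) = ∞ ∨ B(p_c) > 0`, and `SoloInformedBackboneThreshold` that
`B(p) > 0` for every `p > p_c(ℤ^d)`, `d ≥ 2`. Here we add the two order-theoretic facts that make
branch 2 of the dichotomy a statement about the SUPERCRITICAL function `B` on `(p_c, 1]`:

* `measureReal_robust_mono` — `B` is non-decreasing (robustness is an increasing event; monotone
  coupling);
* `measureReal_robust_upperSemicontinuous` — `B` is upper semicontinuous at every `p₀`: it is the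
  infimum over `K` of the probabilities of the LOCAL events
  `R_K = ⋂_{k ≤ K} ({0 ↔ ∂Λ(k)} ∩ ⋂_{e ⊆ Λ(k)} {0 ↔ ∂Λ(k) in ω ∖ e})` ("the one-arm events
  `siteToBoundary d k` hold and still hold after closing any one pair of sites of `Λ(k)`"), each
  determined by the pairs inside `Λ(K)` and hence a polynomial in `p`;

so `B` is right-continuous everywhere (`continuousWithinAt_Ici_measureReal_robust`,
`tendsto_measureReal_robust_nhdsGT`), in particular `B(p_c) = lim_{p ↓ p_c} B(p)`
(`measureReal_robust_criticalProbI_eq_of_tendsto`): the backbone density, unlike possibly `θ`,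
CANNOT jump at `p_c` from the right. Consequently (`jumpWorld_backbone_trichotomy`): if
`θ(p_c) > 0` then `χᶠ(p_c) = ∞`, or the backbone density is bounded below by `B(p_c) > 0` on
the whole closed interval `[p_c, 1]` and tends to `B(p_c)` as `p ↓ p_c`; and
(`percolationContinuity_of_backbone_vanishing`) `B(p) → 0` as `p ↓ p_c` together with
`χᶠ(p_c) < ∞` implies `θ(p_c) = 0`. (`paper/sharpest-statement.md` S17′; Grimmett 1999 §8.3 for
the analogous right-continuity of `θ`.) [folklore]
-/

noncomputable section

namespace Summit.CriticalPhenomena.PercolationContinuityZ3.Theorems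

open MeasureTheory ProbabilityTheory Filter Topology
open Literature.Probability.Percolation Literature.Probability.LatticeModels
open scoped ENNReal

namespace Backbone

variable {d : ℕ}

/-! ## One-arm events and the cluster of the origin -/

/-- An infinite open cluster of the origin, in a lattice configuration, meets every `∂ⁱⁿΛ(n)`
through `Λ(n)`: `ω ∈ {0 ↔ ∂Λ(n)}` (first exit). [folklore] -/
theorem mem_siteToBoundary_of_infinite {ω : BondConfig (Site d)} (hω : ω ⊆ (zdGraph d).edgeSet)
    (hinf : (openCluster ω 0).Infinite) (n : ℕ) : ω ∈ siteToBoundary d n := by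
  obtain ⟨z, hz, hzn⟩ := hinf.exists_notMem_finset (box d n)
  rw [← DCT16.armEvent_zero]
  exact DCT16.armEvent_of_pathIn hω (DCT16.pathIn_univ_of_reachable hz)
    (Or.inl (by rwa [sub_zero]))

/-- If `0 ↔ ∂Λ(n)` for every `n ≥ N₀`, the open cluster of the origin is infinite. [folklore] -/
theorem infinite_of_mem_siteToBoundary {ω : BondConfig (Site d)} {N₀ : ℕ}
    (h : ∀ n, N₀ ≤ n → ω ∈ siteToBoundary d n) : (openCluster ω 0).Infinite := by
  intro hfin
  obtain ⟨N, hN⟩ := DCT16.exists_subset_box hfin.toFinset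
  obtain ⟨y, hy, hpath⟩ := DCT16.mem_siteToBoundary_iff.1 (h (max N₀ N + 1) (by omega))
  have hyC : y ∈ openCluster ω 0 := DCT16.reachable_of_pathIn hpath
  exact DCT16.notMem_box_of_mem_innerBoundary_box (show N < max N₀ N + 1 by omega) hy
    (hN (hfin.mem_toFinset.2 hyC))

/-! ## The local robust-arm events

`{0 ↔ ∂Λ(k)} ∩ ⋂_{e ∈ Λ(k)^{(2)}} {ω ∖ e ∈ {0 ↔ ∂Λ(k)}}` and their running intersections
`R_K` over `k ≤ K` (written out in full in every statement). -/

/-- The level-`k` robust-arm event is measurable. [folklore] -/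
theorem measurableSet_robustArm (k : ℕ) :
    MeasurableSet (siteToBoundary d k ∩
      ⋂ e ∈ (box d k).sym2, closeEdges {e} ⁻¹' siteToBoundary d k) :=
  (DCT16.measurableSet_siteToBoundary d k).inter (MeasurableSet.iInter fun _ =>
    MeasurableSet.iInter fun _ => measurable_closeEdges _ (DCT16.measurableSet_siteToBoundary d k))

/-- `R_K` is measurable. [folklore] -/
theorem measurableSet_robustArms (K : ℕ) :
    MeasurableSet (⋂ k ≤ K, (siteToBoundary d k ∩
      ⋂ e ∈ (box d k).sym2, closeEdges {e} ⁻¹' siteToBoundary d k)) :=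
  MeasurableSet.iInter fun k => MeasurableSet.iInter fun _ => measurableSet_robustArm k

/-- The level-`k` robust-arm event is determined by the pairs of sites of `Λ(k)`. [folklore] -/
theorem determinedBy_robustArm (k : ℕ) :
    DeterminedBy (siteToBoundary d k ∩
        ⋂ e ∈ (box d k).sym2, closeEdges {e} ⁻¹' siteToBoundary d k)
      (↑((box d k).sym2) : Set (Sym2 (Site d))) := by
  have hA := (determinedBy_iff _ _).1 (DCT16.determinedBy_siteToBoundary d k)
  rw [determinedBy_iff]
  intro ω ω' h
  have hcl : ∀ e : Sym2 (Site d),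
      ω \ {e} ∩ ↑((box d k).sym2) = ω' \ {e} ∩ ↑((box d k).sym2) := by
    intro e
    rw [← Set.inter_sdiff_right_comm, ← Set.inter_sdiff_right_comm, h]
  simp only [Set.mem_inter_iff, Set.mem_iInter, Set.mem_preimage, closeEdges]
  rw [hA ω ω' h]
  exact and_congr Iff.rfl (forall_congr' fun e => forall_congr' fun _ => hA _ _ (hcl e))

/-- `R_K` is determined by the pairs of sites of `Λ(K)`. [folklore] -/
theorem determinedBy_robustArms (K : ℕ) :
    DeterminedBy (⋂ k ≤ K, (siteToBoundary d k ∩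
        ⋂ e ∈ (box d k).sym2, closeEdges {e} ⁻¹' siteToBoundary d k))
      (↑((box d K).sym2) : Set (Sym2 (Site d))) := by
  rw [determinedBy_iff]
  intro ω ω' h
  simp only [Set.mem_iInter]
  refine forall_congr' fun k => forall_congr' fun hk => ?_
  exact (determinedBy_iff _ _).1 ((determinedBy_robustArm k).mono
    (Finset.coe_subset.2 (Finset.sym2_mono (box_mono d hk)))) ω ω' h

/-- `p ↦ P_p(R_K)` is continuous. [folklore] -/
theorem continuous_real_robustArms (K : ℕ) :
    Continuous fun p : unitInterval => (bondPercolation (zdGraph d) p).real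
      (⋂ k ≤ K, (siteToBoundary d k ∩
        ⋂ e ∈ (box d k).sym2, closeEdges {e} ⁻¹' siteToBoundary d k)) :=
  continuous_bondPercolation_real_of_determinedBy (zdGraph d) (determinedBy_robustArms K)

/-- `K ↦ R_K` is antitone. [folklore] -/
theorem antitone_robustArms : Antitone fun K => ⋂ k ≤ K, (siteToBoundary d k ∩
      ⋂ e ∈ (box d k).sym2, closeEdges {e} ⁻¹' siteToBoundary d k) := by
  intro K K' hKK' ω hω
  simp only [Set.mem_iInter] at hω ⊢
  exact fun k hk => hω k (hk.trans hKK')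

/-- A robust origin, in a lattice configuration, lies in every `R_K`. [folklore] -/
theorem mem_robustArms_of_mem_robust {ω : BondConfig (Site d)} (hω : ω ⊆ (zdGraph d).edgeSet)
    (h : ω ∈ robust (0 : Site d)) (K : ℕ) :
    ω ∈ ⋂ k ≤ K, (siteToBoundary d k ∩
      ⋂ e ∈ (box d k).sym2, closeEdges {e} ⁻¹' siteToBoundary d k) := by
  simp only [Set.mem_iInter, Set.mem_inter_iff, Set.mem_preimage, closeEdges]
  intro k _
  exact ⟨mem_siteToBoundary_of_infinite hω h.1 k, fun e _ =>
    mem_siteToBoundary_of_infinite (Set.sdiff_subset.trans hω) (h.2 e) k⟩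

/-- Conversely, `⋂_K R_K ⊆ {0 robust}`. [folklore] -/
theorem iInter_robustArms_subset :
    (⋂ K, ⋂ k ≤ K, (siteToBoundary d k ∩
      ⋂ e ∈ (box d k).sym2, closeEdges {e} ⁻¹' siteToBoundary d k)) ⊆ robust (0 : Site d) := by
  intro ω hω
  have hR : ∀ k, ω ∈ siteToBoundary d k ∧
      ∀ e ∈ (box d k).sym2, ω \ {e} ∈ siteToBoundary d k := by
    intro k
    have := Set.mem_iInter.1 hω k
    simp only [Set.mem_iInter, Set.mem_inter_iff, Set.mem_preimage, closeEdges] at this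
    exact this k le_rfl
  refine ⟨infinite_of_mem_siteToBoundary (N₀ := 0) fun n _ => (hR n).1, fun e => ?_⟩
  induction e using Sym2.ind with
  | h a b =>
    obtain ⟨N₀, hN₀⟩ := DCT16.exists_subset_box ({a, b} : Finset (Site d))
    refine infinite_of_mem_siteToBoundary (N₀ := N₀) fun n hn => (hR n).2 _ ?_
    exact Finset.mk_mem_sym2_iff.2
      ⟨box_mono d hn (hN₀ (by simp)), box_mono d hn (hN₀ (by simp))⟩

/-! ## `B` is monotone and upper semicontinuous -/

/-- **`B` is non-decreasing in `p`**: `P_p(0 robust) ≤ P_q(0 robust)` for `p ≤ q` (robustness is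
increasing; monotone coupling). [folklore] -/
theorem measureReal_robust_mono {p q : unitInterval} (hpq : p ≤ q) :
    (bondPercolation (zdGraph d) p).real (robust (0 : Site d)) ≤
      (bondPercolation (zdGraph d) q).real (robust (0 : Site d)) :=
  DCT16.real_mono_of_isUpperSet (zdGraph d) (isUpperSet_robust 0) (measurableSet_robust 0) hpq

/-- `B(p) ≤ P_p(R_K)` for every `K`. [folklore] -/
theorem measureReal_robust_le_robustArms (p : unitInterval) (K : ℕ) :
    (bondPercolation (zdGraph d) p).real (robust (0 : Site d)) ≤
      (bondPercolation (zdGraph d) p).real (⋂ k ≤ K, (siteToBoundary d k ∩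
        ⋂ e ∈ (box d k).sym2, closeEdges {e} ⁻¹' siteToBoundary d k)) :=
  DCT16.real_mono_of_forall_subset_edgeSet (zdGraph d) p fun _ hω h =>
    mem_robustArms_of_mem_robust hω h K

/-- `B(p) = P_p(⋂_K R_K)`. [folklore] -/
theorem measureReal_robust_eq_iInter (p : unitInterval) :
    (bondPercolation (zdGraph d) p).real (robust (0 : Site d)) =
      (bondPercolation (zdGraph d) p).real (⋂ K, ⋂ k ≤ K, (siteToBoundary d k ∩
        ⋂ e ∈ (box d k).sym2, closeEdges {e} ⁻¹' siteToBoundary d k)) :=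
  le_antisymm (DCT16.real_mono_of_forall_subset_edgeSet (zdGraph d) p fun _ hω h =>
      Set.mem_iInter.2 fun K => mem_robustArms_of_mem_robust hω h K)
    (measureReal_mono iInter_robustArms_subset (measure_ne_top _ _))

/-- `P_p(R_K) ↓ B(p)` as `K → ∞`. [folklore] -/
theorem tendsto_real_robustArms (p : unitInterval) :
    Tendsto (fun K => (bondPercolation (zdGraph d) p).real (⋂ k ≤ K, (siteToBoundary d k ∩
        ⋂ e ∈ (box d k).sym2, closeEdges {e} ⁻¹' siteToBoundary d k))) atTop
      (𝓝 ((bondPercolation (zdGraph d) p).real (robust (0 : Site d)))) := by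
  rw [measureReal_robust_eq_iInter]
  have hlim := tendsto_measure_iInter_atTop (μ := bondPercolation (zdGraph d) p)
    (fun K => (measurableSet_robustArms (d := d) K).nullMeasurableSet) antitone_robustArms
    ⟨0, measure_ne_top _ _⟩
  exact (ENNReal.tendsto_toReal (measure_ne_top _ _)).comp hlim

/-- **`B` is upper semicontinuous** at every `p₀`: an infimum of continuous functions. [folklore] -/
theorem measureReal_robust_upperSemicontinuous (p₀ : unitInterval) {η : ℝ} (hη : 0 < η) :
    ∀ᶠ p in 𝓝 p₀, (bondPercolation (zdGraph d) p).real (robust (0 : Site d)) <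
      (bondPercolation (zdGraph d) p₀).real (robust (0 : Site d)) + η := by
  obtain ⟨K, hK⟩ := ((tendsto_order.1 (tendsto_real_robustArms (d := d) p₀)).2 _
    (show (bondPercolation (zdGraph d) p₀).real (robust (0 : Site d)) <
      (bondPercolation (zdGraph d) p₀).real (robust (0 : Site d)) + η by linarith)).exists
  have hcont := (continuous_real_robustArms (d := d) K).continuousAt (x := p₀)
  filter_upwards [(tendsto_order.1 hcont).2 _ hK] with p hp
  exact (measureReal_robust_le_robustArms p K).trans_lt hp

/-- **`B` is right-continuous** at every `p₀` (monotone and upper semicontinuous). [folklore] -/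
theorem continuousWithinAt_Ici_measureReal_robust (p₀ : unitInterval) :
    ContinuousWithinAt
      (fun p : unitInterval => (bondPercolation (zdGraph d) p).real (robust (0 : Site d)))
      (Set.Ici p₀) p₀ := by
  rw [ContinuousWithinAt, Metric.tendsto_nhds]
  intro η hη
  have h2 : ∀ᶠ p in 𝓝[Set.Ici p₀] p₀, p₀ ≤ p := eventually_nhdsWithin_of_forall fun p hp => hp
  filter_upwards [nhdsWithin_le_nhds (measureReal_robust_upperSemicontinuous (d := d) p₀ hη), h2]
    with p hp hp'
  rw [Real.dist_eq, abs_lt]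
  exact ⟨by linarith [measureReal_robust_mono (d := d) hp'], by linarith⟩

/-- `B(p) → B(p₀)` as `p ↓ p₀`. [folklore] -/
theorem tendsto_measureReal_robust_nhdsGT (p₀ : unitInterval) :
    Tendsto (fun p : unitInterval => (bondPercolation (zdGraph d) p).real (robust (0 : Site d)))
      (𝓝[>] p₀) (𝓝 ((bondPercolation (zdGraph d) p₀).real (robust (0 : Site d)))) :=
  (continuousWithinAt_Ici_measureReal_robust p₀).tendsto.mono_left
    (nhdsWithin_mono _ Set.Ioi_subset_Ici_self)

/-- The right neighbourhoods of `p_c(ℤ^d)` in `[0,1]` form a proper filter (`p_c < 1`, `d ≥ 2`).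
[folklore] -/
theorem nhdsGT_criticalProbI_neBot (hd : 2 ≤ d) : NeBot (𝓝[>] (criticalProbI d)) := by
  refine nhdsGT_neBot_of_exists_gt ⟨1, ?_⟩
  change criticalProbI d < 1
  rw [← Subtype.coe_lt_coe, coe_criticalProbI]
  exact criticalProb_zd_lt_one hd

/-! ## At `p_c`: the backbone density does not jump from the right -/

/-- **`B(p_c) = lim_{p ↓ p_c} B(p)`**, `d ≥ 2`: whatever `B(p)` tends to as `p ↓ p_c(ℤ^d)` IS the
critical backbone density. [folklore] -/
theorem measureReal_robust_criticalProbI_eq_of_tendsto (hd : 2 ≤ d) {b : ℝ}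
    (h : Tendsto (fun p : unitInterval => (bondPercolation (zdGraph d) p).real (robust (0 : Site d)))
      (𝓝[>] (criticalProbI d)) (𝓝 b)) :
    (bondPercolation (zdGraph d) (criticalProbI d)).real (robust (0 : Site d)) = b :=
  have := nhdsGT_criticalProbI_neBot hd
  tendsto_nhds_unique (tendsto_measureReal_robust_nhdsGT _) h

/-- **The jump world, sharpened (S17′).** If `θ(p_c) > 0`, `d ≥ 2`, then either `χᶠ(p_c) = ∞`, or
the backbone density is bounded below by `B(p_c) > 0` on the whole of `[p_c, 1]` AND tends to
`B(p_c)` as `p ↓ p_c` — branch 2 is decided by the supercritical function `B` alone. [folklore] -/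
theorem jumpWorld_backbone_trichotomy (hd : 2 ≤ d) (h : ¬ PercolationContinuity d) :
    (¬ Summable fun a : Site d =>
        (bondPercolation (zdGraph d) (criticalProbI d)).real (finConn (0 : Site d) a)) ∨
      (0 < (bondPercolation (zdGraph d) (criticalProbI d)).real (robust (0 : Site d)) ∧
        (∀ p : unitInterval, criticalProbI d ≤ p →
          (bondPercolation (zdGraph d) (criticalProbI d)).real (robust (0 : Site d)) ≤
            (bondPercolation (zdGraph d) p).real (robust (0 : Site d))) ∧
        Tendsto (fun p : unitInterval => (bondPercolation (zdGraph d) p).real (robust (0 : Site d)))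
          (𝓝[>] (criticalProbI d))
          (𝓝 ((bondPercolation (zdGraph d) (criticalProbI d)).real (robust (0 : Site d))))) := by
  rcases jumpWorld_dichotomy hd h with hχ | hB
  · exact Or.inl hχ
  · exact Or.inr ⟨hB, fun p hp => measureReal_robust_mono hp,
      tendsto_measureReal_robust_nhdsGT _⟩

/-- **Continuity from a vanishing backbone.** If the backbone density vanishes as `p ↓ p_c(ℤ^d)`
and the finite-cluster susceptibility is finite at `p_c`, then `θ(p_c) = 0` (`d ≥ 2`). [folklore] -/
theorem percolationContinuity_of_backbone_vanishing (hd : 2 ≤ d)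
    (hB : Tendsto (fun p : unitInterval => (bondPercolation (zdGraph d) p).real (robust (0 : Site d)))
      (𝓝[>] (criticalProbI d)) (𝓝 0))
    (hχ : Summable fun a : Site d =>
      (bondPercolation (zdGraph d) (criticalProbI d)).real (finConn (0 : Site d) a)) :
    PercolationContinuity d := by
  by_contra h
  rcases jumpWorld_dichotomy hd h with hχ' | hpos
  · exact hχ' hχ
  · exact hpos.ne' (measureReal_robust_criticalProbI_eq_of_tendsto hd hB)

/-- The case `d = 3`: a backbone density vanishing as `p ↓ p_c(ℤ³)` and `χᶠ(p_c) < ∞` give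
`PercolationContinuityZ3`. [folklore] -/
theorem percolationContinuityZ3_of_backbone_vanishing
    (hB : Tendsto (fun p : unitInterval => (bondPercolation (zdGraph 3) p).real (robust (0 : Site 3)))
      (𝓝[>] (criticalProbI 3)) (𝓝 0))
    (hχ : Summable fun a : Site 3 =>
      (bondPercolation (zdGraph 3) (criticalProbI 3)).real (finConn (0 : Site 3) a)) :
    PercolationContinuityZ3 :=
  percolationContinuity_of_backbone_vanishing (by norm_num) hB hχ

end Backbone

end Summit.CriticalPhenomena.PercolationContinuityZ3.Theorems

end
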